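import Summits.QuantumAdvantage.QuantumAdvantage.Theorems.SosSandwichPseudoBoundedAABooleanCornerOSSS
import Literature.Computability.QuantumComplexity.PseudoBounded
import HarnessLib

/-!
# Crux `PseudoBoundedAA` (stmt-QuantumAdvantage-15237, route SosSandwich) — THE CLASSICAL CORNER OF PB-AA:
# acceptance probabilities of randomized classical query algorithms have influential variables, `16·Var² ≤ D̄²·maxᵢ Infᵢ`

Support file for the rank-2 crux PB-AA (`Theses/SosSandwich.lean`, item stmt-QuantumAdvantage-15237): pseudo-bounded
polynomials of order `T` (the SOS sandwich class `K_T`: `p = Σ qⱼ²`, `1 − p = Σ rⱼ²` on the cube, `deg ≤ T`) with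
`Var ≥ ε` should have a variable of influence `≥ C (ε/T)^c`; the card's sharp prediction is `(c, exponent of T) = (2, 2)`.

Aaronson–Ambainis (arXiv:0911.0996, p. 6, after Thm 8) remark that O'Donnell–Saks–Schramm–Servedio's theorem "every
decision tree has an influential variable" *does not directly imply anything* about acceptance probabilities, because an
acceptance probability need not approximate a total Boolean function.  For CLASSICAL randomized algorithms that
obstruction disappears: this file proves, in kernel and with complete proofs, that the acceptance probability
`p(x) = Σ_k w_k · [t_k accepts x]` of ANY finite mixture of deterministic decision trees (`w_k ≥ 0`) satisfies

  `Var[p] ≤ D̄ · √(maxⱼ Infⱼ[p]) / 4`,  `D̄ := Σ_k w_k · depth(t_k)` (the expected worst-case number of queries),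

hence `16 · Var[p]² ≤ D̄² · maxⱼ Infⱼ[p]`, with NO approximation or Booleanity hypothesis on `p`.  The proof averages the
tree's TWO-FUNCTION OSSS inequality in depth form (`BooleanCorner.osss_depth`: `2^N Σ F g − (Σ F)(Σ g) ≤ depth·2^N·M/4`
for the `0/1` output `F` of a tree and any real `g` with `L¹` increments `≤ M`) over the mixture with `g := p`
(`Var[p] = Σ_k w_k Cov([t_k accepts], p)`), and bounds the `L¹` increments of `p` by `2^N √Infⱼ[p]` (Cauchy–Schwarz).

Since every mixture of depth-`≤ T` trees with `Σ w_k = 1` lies in `K_T` (`pseudoBounded_of_mixture`: the tree outputs are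
`{0,1}`-valued polynomials `q_k` of degree `≤ depth`, `exists_poly_of_decisionTree`, and `p = Σ (√w_k q_k)²`,
`1 − p = Σ (√w_k (1 − q_k))²`), this is a genuine sub-cone `R_T ⊆ K_T` of the crux — the classical corner — on which the
body of `PseudoBoundedAA` holds with the card's sharp exponent pair and `C = 16` (`pseudoBoundedAA_classicalCorner`, literal
inline vocabulary of the route item, the SOS hypothesis replaced by the stronger mixture hypothesis).  The exponent `2` in
`ε` is attained on the corner already at `T = 1` (query a uniformly random variable and output it: `Var = 1/(4N)`,
`Infᵢ = 1/N² = 16·Var²`).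

* `abs_update_sub_eq`, `sum_abs_update_le_sqrt_influence` — `Σₓ |p(x^{j→1}) − p(x^{j→0})| ≤ 2^N · √Infⱼ[p]`;
* `osss_mixture` — the two-function OSSS inequality for mixtures, sum form, with the AVERAGE depth `D̄`;
* `exists_influence_ge_of_mixture` (`Var ≤ D̄ √maxInf / 4`), `exists_influence_ge_of_mixture_sq` (`16 Var² ≤ D̄² maxInf`),
  `exists_influence_ge_of_mixture_depth_le` (`16 Var² ≤ D² maxInf` when all depths `≤ D` and `Σ w ≤ 1`);
* `exists_poly_of_decisionTree`, `pseudoBounded_of_mixture` — `R_T ⊆ K_T`;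
* **`pseudoBoundedAA_classicalCorner`** — `∀ N T p ε, 1 ≤ T → (p is on the cube a mixture of depth-≤T trees) → 0 < ε ≤ Var[p]
  → ∃ i, 16 (ε/T)² ≤ Infᵢ[p]`.

Honest label: a corner of an open conjecture (two-function OSSS + averaging; folklore-strength, new to the tree); no stub,
crux or summit is closed.  Sources: R. O'Donnell, M. Saks, O. Schramm, R. Servedio, *Every decision tree has an influential
variable*, FOCS 2005, Thm 3.2; S. Aaronson, A. Ambainis, *The need for structure in quantum speedups*, arXiv:0911.0996,
Conj. 6 / Thm 8 and the remark following it; R. O'Donnell, *Analysis of Boolean Functions* (CUP 2014) §8.6.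
-/

set_option linter.dupNamespace false

noncomputable section

namespace Summit.QuantumAdvantage.QuantumAdvantage.Theorems.SosSandwich

open Finset Function
open Literature.Computability.Complexity Literature.Computability.QuantumComplexity

namespace ClassicalCorner

variable {N : ℕ}

/-! ### The `L¹` increment of a real function on the cube is at most `2^N √Inf` -/

/-- Pointwise, the increment across coordinate `j` is the flip increment: `|g(x^{j→1}) − g(x^{j→0})| = |g(x) − g(xʲ)|`.
[folklore] -/
theorem abs_update_sub_eq (g : (Fin N → Bool) → ℝ) (j : Fin N) (x : Fin N → Bool) :
    |g (update x j true) - g (update x j false)| = |g x - g (flipBit j x)| := by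
  dsimp only [flipBit]
  rcases Bool.eq_false_or_eq_true (x j) with hx | hx
  · have hu : update x j true = x := by rw [← hx]; exact update_eq_self j x
    rw [hu, hx, Bool.not_true]
  · have hu : update x j false = x := by rw [← hx]; exact update_eq_self j x
    rw [hu, hx, Bool.not_false, abs_sub_comm]

/-- **Cauchy–Schwarz step.** The `L¹` increment of a polynomial `p` across coordinate `j` is at most `2^N · √Infⱼ[p]`
(`Σₓ |p(x) − p(xʲ)| ≤ √(2^N) · √(Σₓ (p(x) − p(xʲ))²) = 2^N √Infⱼ[p]`). [folklore] -/
theorem sum_abs_update_le_sqrt_influence (p : MvPolynomial (Fin N) ℝ) (j : Fin N) :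
    ∑ x, |evalBool p (update x j true) - evalBool p (update x j false)|
      ≤ (2 : ℝ) ^ N * Real.sqrt (influence j p) := by
  have h2N : (0 : ℝ) < (2 : ℝ) ^ N := by positivity
  set d : (Fin N → Bool) → ℝ := fun x => evalBool p x - evalBool p (flipBit j x) with hd
  have hsum : ∑ x, |evalBool p (update x j true) - evalBool p (update x j false)| = ∑ x, |d x| :=
    Finset.sum_congr rfl fun x _ => abs_update_sub_eq (evalBool p) j x
  have hinf : ∑ x, d x ^ 2 = (2 : ℝ) ^ N * influence j p := by
    unfold influence boolAvg
    rw [mul_div_cancel₀ _ h2N.ne']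
  have hcs : (∑ x, |d x| * 1) ^ 2 ≤ (∑ x, |d x| ^ 2) * ∑ _x : Fin N → Bool, (1 : ℝ) ^ 2 :=
    Finset.sum_mul_sq_le_sq_mul_sq _ _ _
  have hone : ∑ _x : Fin N → Bool, (1 : ℝ) ^ 2 = (2 : ℝ) ^ N := by
    rw [Finset.sum_const, Finset.card_univ, BooleanCorner.card_cube_nat, nsmul_eq_mul]
    push_cast
    ring
  have habs : ∑ x, |d x| ^ 2 = ∑ x, d x ^ 2 := Finset.sum_congr rfl fun x _ => sq_abs _
  simp only [mul_one] at hcs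
  rw [hone, habs, hinf] at hcs
  -- `hcs : (Σ |d|)² ≤ (2^N Inf) · 2^N = (2^N √Inf)²`
  have hI := influence_nonneg j p
  have hA : 0 ≤ ∑ x, |d x| := Finset.sum_nonneg fun _ _ => abs_nonneg _
  have hB : 0 ≤ (2 : ℝ) ^ N * Real.sqrt (influence j p) := by positivity
  have hsq : (∑ x, |d x|) ^ 2 ≤ ((2 : ℝ) ^ N * Real.sqrt (influence j p)) ^ 2 := by
    calc (∑ x, |d x|) ^ 2 ≤ (2 : ℝ) ^ N * influence j p * (2 : ℝ) ^ N := hcs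
      _ = ((2 : ℝ) ^ N * Real.sqrt (influence j p)) ^ 2 := by
          rw [mul_pow, Real.sq_sqrt hI]; ring
  rw [hsum]
  calc ∑ x, |d x| = Real.sqrt ((∑ x, |d x|) ^ 2) := (Real.sqrt_sq hA).symm
    _ ≤ Real.sqrt (((2 : ℝ) ^ N * Real.sqrt (influence j p)) ^ 2) := Real.sqrt_le_sqrt hsq
    _ = (2 : ℝ) ^ N * Real.sqrt (influence j p) := Real.sqrt_sq hB

/-! ### OSSS for mixtures of decision trees -/

/-- **Two-function OSSS inequality for MIXTURES of decision trees, sum form.** If `P(x) = Σ_{k∈s} w_k·[t_k accepts x]` with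
`w_k ≥ 0` and the real function `g` has all `L¹` increments `Σₓ |g(x^{j→1}) − g(x^{j→0})| ≤ M`, then
`2^N Σₓ P g − (Σ P)(Σ g) ≤ D̄ · 2^N · M / 4` with `D̄ = Σ_k w_k · depth(t_k)` — the tree's `osss_depth` for each `t_k`,
averaged with the weights (covariance is linear in the first argument). [cite: OdonnellEtAl2005, Thm 3.2] -/
theorem osss_mixture {ι : Type*} (s : Finset ι) (w : ι → ℝ) (hw : ∀ k ∈ s, 0 ≤ w k)
    (t : ι → DecisionTree N) (P g : (Fin N → Bool) → ℝ)
    (hP : ∀ x, P x = ∑ k ∈ s, w k * (if (t k).eval x = true then (1 : ℝ) else 0))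
    (M : ℝ) (hM : 0 ≤ M) (hg : ∀ j : Fin N, ∑ x, |g (update x j true) - g (update x j false)| ≤ M) :
    (2 : ℝ) ^ N * (∑ x, P x * g x) - (∑ x, P x) * (∑ x, g x)
      ≤ (∑ k ∈ s, w k * ((t k).depth : ℝ)) * (2 : ℝ) ^ N * M / 4 := by
  -- the `0/1` outputs of the trees
  set F : ι → (Fin N → Bool) → ℝ := fun k x => if (t k).eval x = true then (1 : ℝ) else 0 with hF
  have hPg : ∑ x, P x * g x = ∑ k ∈ s, w k * ∑ x, F k x * g x := by
    calc ∑ x, P x * g x = ∑ x, ∑ k ∈ s, w k * (F k x * g x) := by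
          refine Finset.sum_congr rfl fun x _ => ?_
          rw [hP x, Finset.sum_mul]
          exact Finset.sum_congr rfl fun k _ => by ring
      _ = ∑ k ∈ s, ∑ x, w k * (F k x * g x) := Finset.sum_comm
      _ = ∑ k ∈ s, w k * ∑ x, F k x * g x :=
          Finset.sum_congr rfl fun k _ => by rw [Finset.mul_sum]
  have hPs : ∑ x, P x = ∑ k ∈ s, w k * ∑ x, F k x := by
    calc ∑ x, P x = ∑ x, ∑ k ∈ s, w k * F k x := Finset.sum_congr rfl fun x _ => hP x
      _ = ∑ k ∈ s, ∑ x, w k * F k x := Finset.sum_comm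
      _ = ∑ k ∈ s, w k * ∑ x, F k x := Finset.sum_congr rfl fun k _ => by rw [Finset.mul_sum]
  have hlin : (2 : ℝ) ^ N * (∑ x, P x * g x) - (∑ x, P x) * (∑ x, g x)
      = ∑ k ∈ s, w k * ((2 : ℝ) ^ N * (∑ x, F k x * g x) - (∑ x, F k x) * (∑ x, g x)) := by
    rw [hPg, hPs, Finset.mul_sum, Finset.sum_mul, ← Finset.sum_sub_distrib]
    exact Finset.sum_congr rfl fun k _ => by ring
  rw [hlin]
  have hrhs : (∑ k ∈ s, w k * ((t k).depth : ℝ)) * (2 : ℝ) ^ N * M / 4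
      = ∑ k ∈ s, w k * (((t k).depth : ℝ) * (2 : ℝ) ^ N * M / 4) := by
    rw [Finset.sum_mul, Finset.sum_mul, Finset.sum_div]
    exact Finset.sum_congr rfl fun k _ => by ring
  rw [hrhs]
  refine Finset.sum_le_sum fun k hk => ?_
  exact mul_le_mul_of_nonneg_left (BooleanCorner.osss_depth (t k) (F k) g M (fun x => rfl) hM hg) (hw k hk)

/-- **Every randomized classical query algorithm has an influential variable.** If the real polynomial `p` takes on the
cube the values `Σ_{k∈s} w_k·[t_k accepts x]` of a finite mixture of decision trees (`w_k ≥ 0`) and `Var[p] > 0`, then for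
the variable `j` of largest influence `Var[p] ≤ D̄ · √Infⱼ[p] / 4`, `D̄ = Σ_k w_k·depth(t_k)`. No Booleanity or
approximation hypothesis on `p` is needed (contrast `BooleanCorner.exists_influence_ge_of_decisionTree`).
[cite: OdonnellEtAl2005, Thm 3.2] [cite: AaronsonAmbainis2014, Thm 8 and the remark following it] -/
theorem exists_influence_ge_of_mixture {ι : Type*} (s : Finset ι) (w : ι → ℝ) (hw : ∀ k ∈ s, 0 ≤ w k)
    (t : ι → DecisionTree N) (p : MvPolynomial (Fin N) ℝ)
    (hp : ∀ x, evalBool p x = ∑ k ∈ s, w k * (if (t k).eval x = true then (1 : ℝ) else 0))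
    (hv : 0 < boolVariance p) :
    ∃ j : Fin N, boolVariance p ≤ (∑ k ∈ s, w k * ((t k).depth : ℝ)) * Real.sqrt (influence j p) / 4 := by
  classical
  rcases Nat.eq_zero_or_pos N with hN0 | hNpos
  · subst hN0
    exact absurd (BooleanCorner.boolVariance_fin_zero p) (ne_of_gt hv)
  have hne : (Finset.univ : Finset (Fin N)).Nonempty := ⟨⟨0, hNpos⟩, Finset.mem_univ _⟩
  obtain ⟨j, -, hj⟩ := Finset.exists_max_image Finset.univ (fun j => influence j p) hne
  refine ⟨j, ?_⟩
  have h2N : (0 : ℝ) < (2 : ℝ) ^ N := by positivity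
  have hMj : ∀ j' : Fin N, ∑ x, |evalBool p (update x j' true) - evalBool p (update x j' false)|
      ≤ (2 : ℝ) ^ N * Real.sqrt (influence j p) := fun j' =>
    (sum_abs_update_le_sqrt_influence p j').trans
      (mul_le_mul_of_nonneg_left (Real.sqrt_le_sqrt (hj j' (Finset.mem_univ _))) h2N.le)
  have key := osss_mixture s w hw t (evalBool p) (evalBool p) hp
    ((2 : ℝ) ^ N * Real.sqrt (influence j p)) (by positivity) hMj
  rw [BooleanCorner.sum_sq_sub_sq_sum_eq] at key
  have key' : (2 : ℝ) ^ N * ((2 : ℝ) ^ N * boolVariance p)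
      ≤ (2 : ℝ) ^ N * ((2 : ℝ) ^ N *
          ((∑ k ∈ s, w k * ((t k).depth : ℝ)) * Real.sqrt (influence j p) / 4)) := by
    calc (2 : ℝ) ^ N * ((2 : ℝ) ^ N * boolVariance p)
        ≤ (∑ k ∈ s, w k * ((t k).depth : ℝ)) * (2 : ℝ) ^ N * ((2 : ℝ) ^ N * Real.sqrt (influence j p)) / 4 := key
      _ = _ := by ring
  exact le_of_mul_le_mul_left (le_of_mul_le_mul_left key' h2N) h2N

/-- Squared form: `16 · Var[p]² ≤ D̄² · Infⱼ[p]` for some `j` — the Aaronson–Ambainis shape with the SHARP exponent `2`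
in the variance (attained at `T = 1`: query a uniformly random variable and output it). [cite: OdonnellEtAl2005, Thm 3.2] -/
theorem exists_influence_ge_of_mixture_sq {ι : Type*} (s : Finset ι) (w : ι → ℝ) (hw : ∀ k ∈ s, 0 ≤ w k)
    (t : ι → DecisionTree N) (p : MvPolynomial (Fin N) ℝ)
    (hp : ∀ x, evalBool p x = ∑ k ∈ s, w k * (if (t k).eval x = true then (1 : ℝ) else 0))
    (hv : 0 < boolVariance p) :
    ∃ j : Fin N, 16 * boolVariance p ^ 2 ≤ (∑ k ∈ s, w k * ((t k).depth : ℝ)) ^ 2 * influence j p := by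
  obtain ⟨j, hj⟩ := exists_influence_ge_of_mixture s w hw t p hp hv
  refine ⟨j, ?_⟩
  have hI := influence_nonneg j p
  have h4 : 4 * boolVariance p ≤ (∑ k ∈ s, w k * ((t k).depth : ℝ)) * Real.sqrt (influence j p) := by
    linarith
  calc 16 * boolVariance p ^ 2 = (4 * boolVariance p) ^ 2 := by ring
    _ ≤ ((∑ k ∈ s, w k * ((t k).depth : ℝ)) * Real.sqrt (influence j p)) ^ 2 :=
        pow_le_pow_left₀ (by linarith) h4 2
    _ = (∑ k ∈ s, w k * ((t k).depth : ℝ)) ^ 2 * influence j p := by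
        rw [mul_pow, Real.sq_sqrt hI]

/-- Depth form: if every tree of the mixture has depth `≤ D` and the weights sum to at most `1`, then
`16 · Var[p]² ≤ D² · Infⱼ[p]` for some `j`. [cite: OdonnellEtAl2005, Thm 3.2] -/
theorem exists_influence_ge_of_mixture_depth_le {ι : Type*} (s : Finset ι) (w : ι → ℝ)
    (hw : ∀ k ∈ s, 0 ≤ w k) (hw1 : ∑ k ∈ s, w k ≤ 1)
    (t : ι → DecisionTree N) (D : ℕ) (hD : ∀ k ∈ s, (t k).depth ≤ D) (p : MvPolynomial (Fin N) ℝ)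
    (hp : ∀ x, evalBool p x = ∑ k ∈ s, w k * (if (t k).eval x = true then (1 : ℝ) else 0))
    (hv : 0 < boolVariance p) :
    ∃ j : Fin N, 16 * boolVariance p ^ 2 ≤ (D : ℝ) ^ 2 * influence j p := by
  obtain ⟨j, hj⟩ := exists_influence_ge_of_mixture_sq s w hw t p hp hv
  refine ⟨j, hj.trans ?_⟩
  have hI := influence_nonneg j p
  have hDbar0 : 0 ≤ ∑ k ∈ s, w k * ((t k).depth : ℝ) :=
    Finset.sum_nonneg fun k hk => mul_nonneg (hw k hk) (Nat.cast_nonneg _)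
  have hDbar : ∑ k ∈ s, w k * ((t k).depth : ℝ) ≤ D := by
    calc ∑ k ∈ s, w k * ((t k).depth : ℝ) ≤ ∑ k ∈ s, w k * (D : ℝ) :=
          Finset.sum_le_sum fun k hk =>
            mul_le_mul_of_nonneg_left (by exact_mod_cast hD k hk) (hw k hk)
      _ = (∑ k ∈ s, w k) * D := by rw [Finset.sum_mul]
      _ ≤ 1 * D := by gcongr
      _ = D := one_mul _
  gcongr

/-! ### The classical corner is a sub-cone of the sandwich class: `R_T ⊆ K_T` -/

/-- The `0/1` output of a decision tree is, on the cube, a real polynomial of total degree at most the depth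
(`leaf b ↦ b`, `query i t₀ t₁ ↦ xᵢ·q₁ + (1 − xᵢ)·q₀`). [cite: Wolf2002, §2.1] [cite: BealsEtAl2001, Lemma 4.2 (classical case)] -/
theorem exists_poly_of_decisionTree (t : DecisionTree N) :
    ∃ q : MvPolynomial (Fin N) ℝ, q.totalDegree ≤ t.depth ∧
      ∀ x, evalBool q x = if t.eval x = true then (1 : ℝ) else 0 := by
  induction t with
  | leaf b =>
    refine ⟨MvPolynomial.C (if b = true then (1 : ℝ) else 0), ?_, fun x => ?_⟩
    · rw [MvPolynomial.totalDegree_C]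
      exact Nat.zero_le _
    · simp only [evalBool, MvPolynomial.eval_C, DecisionTree.eval_leaf]
      cases b <;> simp
  | query i t₀ t₁ ih₀ ih₁ =>
    obtain ⟨q₀, hd₀, he₀⟩ := ih₀
    obtain ⟨q₁, hd₁, he₁⟩ := ih₁
    refine ⟨MvPolynomial.X i * q₁ + (1 - MvPolynomial.X i) * q₀, ?_, fun x => ?_⟩
    · have hX : (MvPolynomial.X i : MvPolynomial (Fin N) ℝ).totalDegree ≤ 1 := by
        rw [MvPolynomial.totalDegree_X]
      have h1X : (1 - MvPolynomial.X i : MvPolynomial (Fin N) ℝ).totalDegree ≤ 1 := by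
        refine (MvPolynomial.totalDegree_sub _ _).trans (max_le ?_ hX)
        rw [MvPolynomial.totalDegree_one]
        exact Nat.zero_le _
      rw [DecisionTree.depth_query]
      refine (MvPolynomial.totalDegree_add _ _).trans (max_le ?_ ?_)
      · refine (MvPolynomial.totalDegree_mul _ _).trans ?_
        calc (MvPolynomial.X i : MvPolynomial (Fin N) ℝ).totalDegree + q₁.totalDegree
            ≤ 1 + t₁.depth := Nat.add_le_add hX hd₁
          _ ≤ max t₀.depth t₁.depth + 1 := by omega
      · refine (MvPolynomial.totalDegree_mul _ _).trans ?_
        calc (1 - MvPolynomial.X i : MvPolynomial (Fin N) ℝ).totalDegree + q₀.totalDegree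
            ≤ 1 + t₀.depth := Nat.add_le_add h1X hd₀
          _ ≤ max t₀.depth t₁.depth + 1 := by omega
    · have he₀' := he₀ x
      have he₁' := he₁ x
      simp only [evalBool] at he₀' he₁' ⊢
      rw [map_add, map_mul, map_mul, map_sub, map_one, MvPolynomial.eval_X, he₀', he₁',
        DecisionTree.eval_query]
      cases x i <;> simp

/-- **`R_T ⊆ K_T`.** A polynomial whose cube values are a probability mixture (`w_k ≥ 0`, `Σ w_k = 1`) of the outputs of
decision trees of depth `≤ T` is pseudo-bounded of order `T`: with `q_k` the degree-`≤ T` polynomial of `t_k`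
(`{0,1}`-valued on the cube), `p = Σ_k (√w_k·q_k)²` and `1 − p = Σ_k (√w_k·(1 − q_k))²` on the cube.
[cite: KaniewskiLeeDewolf2015, Def. 7] [cite: OdonnellEtAl2005, Thm 3.2] -/
theorem pseudoBounded_of_mixture {ι : Type*} [Fintype ι] (w : ι → ℝ) (hw : ∀ k, 0 ≤ w k)
    (hw1 : ∑ k, w k = 1) (t : ι → DecisionTree N) (T : ℕ) (hT : ∀ k, (t k).depth ≤ T)
    (p : MvPolynomial (Fin N) ℝ)
    (hp : ∀ x, evalBool p x = ∑ k, w k * (if (t k).eval x = true then (1 : ℝ) else 0)) :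
    PseudoBounded T p := by
  classical
  choose q hqdeg hqev using fun k => exists_poly_of_decisionTree (t k)
  -- reindex the family along `Fin (card ι)`
  let e : Fin (Fintype.card ι) ≃ ι := (Fintype.equivFin ι).symm
  refine ⟨Fintype.card ι, fun m => MvPolynomial.C (Real.sqrt (w (e m))) * q (e m),
    fun m => MvPolynomial.C (Real.sqrt (w (e m))) * (1 - q (e m)), fun m => ⟨?_, ?_⟩, fun x => ⟨?_, ?_⟩⟩
  · refine (MvPolynomial.totalDegree_mul _ _).trans ?_
    rw [MvPolynomial.totalDegree_C, zero_add]
    exact (hqdeg (e m)).trans (hT (e m))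
  · refine (MvPolynomial.totalDegree_mul _ _).trans ?_
    rw [MvPolynomial.totalDegree_C, zero_add]
    refine (MvPolynomial.totalDegree_sub _ _).trans (max_le ?_ ((hqdeg (e m)).trans (hT (e m))))
    rw [MvPolynomial.totalDegree_one]
    exact Nat.zero_le _
  · -- `p(x) = Σ_m (√w q)(x)² = Σ_m w·q(x)` since `q(x) ∈ {0,1}`
    have hq01 : ∀ k, (evalBool (q k) x) ^ 2 = evalBool (q k) x := by
      intro k; rw [hqev k x]; split_ifs <;> norm_num
    change evalBool p x = ∑ m, (evalBool (MvPolynomial.C (Real.sqrt (w (e m))) * q (e m)) x) ^ 2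
    have hterm : ∀ m, (evalBool (MvPolynomial.C (Real.sqrt (w (e m))) * q (e m)) x) ^ 2
        = w (e m) * (if (t (e m)).eval x = true then (1 : ℝ) else 0) := by
      intro m
      have : evalBool (MvPolynomial.C (Real.sqrt (w (e m))) * q (e m)) x
          = Real.sqrt (w (e m)) * evalBool (q (e m)) x := by
        simp only [evalBool, map_mul, MvPolynomial.eval_C]
      rw [this, mul_pow, Real.sq_sqrt (hw _), hq01, hqev]
    rw [Fintype.sum_congr _ _ hterm, hp x]
    exact (Equiv.sum_comp e (fun k => w k * (if (t k).eval x = true then (1 : ℝ) else 0))).symm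
  · have hq01' : ∀ k, (1 - evalBool (q k) x) ^ 2 = 1 - evalBool (q k) x := by
      intro k; rw [hqev k x]; split_ifs <;> norm_num
    change 1 - evalBool p x = ∑ m, (evalBool (MvPolynomial.C (Real.sqrt (w (e m))) * (1 - q (e m))) x) ^ 2
    have hterm : ∀ m, (evalBool (MvPolynomial.C (Real.sqrt (w (e m))) * (1 - q (e m))) x) ^ 2
        = w (e m) * (1 - (if (t (e m)).eval x = true then (1 : ℝ) else 0)) := by
      intro m
      have : evalBool (MvPolynomial.C (Real.sqrt (w (e m))) * (1 - q (e m))) x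
          = Real.sqrt (w (e m)) * (1 - evalBool (q (e m)) x) := by
        simp only [evalBool, map_mul, map_sub, map_one, MvPolynomial.eval_C]
      rw [this, mul_pow, Real.sq_sqrt (hw _), hq01', hqev]
    rw [Fintype.sum_congr _ _ hterm, hp x]
    have hre : ∑ a, w (e a) * (1 - (if (t (e a)).eval x = true then (1 : ℝ) else 0))
        = ∑ k, w k * (1 - (if (t k).eval x = true then (1 : ℝ) else 0)) :=
      Equiv.sum_comp e (fun k => w k * (1 - (if (t k).eval x = true then (1 : ℝ) else 0)))
    rw [hre]
    simp only [mul_sub, mul_one, Finset.sum_sub_distrib, hw1]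

/-! ### The body of `PseudoBoundedAA` on the classical corner, literal vocabulary, `(c, C) = (2, 16)` -/

/-- **PB-AA ON THE CLASSICAL CORNER, with the card's sharp exponent pair `(2, 2)`.** In the literal inline vocabulary of
the route item `Theses.SosSandwich.PseudoBoundedAA` (`ev` = `evalBool`, `avg` = `boolAvg` by `rfl`), with the SOS-sandwich
hypothesis replaced by the STRONGER hypothesis "`p` is on the cube the acceptance probability of a randomized classical
algorithm making at most `T` queries" (a probability mixture of decision trees of depth `≤ T`; such `p` lie in `K_T` by
`pseudoBounded_of_mixture`): `∀ N T p ε, 1 ≤ T → (mixture) → 0 < ε ≤ Var[p] → ∃ i, 16·(ε/T)² ≤ Infᵢ[p]`.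
[cite: OdonnellEtAl2005, Thm 3.2] [cite: AaronsonAmbainis2014, Conj. 6, Thm 8 and the remark following it] -/
theorem pseudoBoundedAA_classicalCorner (N T : ℕ) (p : MvPolynomial (Fin N) ℝ) (ε : ℝ) :
    let ev : MvPolynomial (Fin N) ℝ → (Fin N → Bool) → ℝ :=
      fun f x => MvPolynomial.eval (fun k => if x k then (1 : ℝ) else 0) f
    let avg : ((Fin N → Bool) → ℝ) → ℝ := fun g => (∑ x : Fin N → Bool, g x) / (2 : ℝ) ^ N
    1 ≤ T →
    (∃ (m : ℕ) (w : Fin m → ℝ) (t : Fin m → DecisionTree N),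
        (∀ k, 0 ≤ w k) ∧ ∑ k, w k = 1 ∧ (∀ k, (t k).depth ≤ T) ∧
          ∀ x : Fin N → Bool, ev p x = ∑ k, w k * (if (t k).eval x = true then (1 : ℝ) else 0)) →
    0 < ε → ε ≤ (avg fun x => (ev p x - avg (ev p)) ^ 2) →
    ∃ i : Fin N, 16 * (ε / T) ^ 2 ≤ (avg fun x => (ev p x - ev p (Function.update x i (!x i))) ^ 2) := by
  intro ev avg hT hmix hε hεV
  obtain ⟨m, w, t, hw, hw1, htd, hp⟩ := hmix
  have hp' : ∀ x, evalBool p x = ∑ k ∈ Finset.univ, w k * (if (t k).eval x = true then (1 : ℝ) else 0) := hp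
  have hεV' : ε ≤ boolVariance p := hεV
  have hv : 0 < boolVariance p := lt_of_lt_of_le hε hεV'
  obtain ⟨i, hi⟩ := exists_influence_ge_of_mixture_depth_le Finset.univ w (fun k _ => hw k) (le_of_eq hw1) t T
    (fun k _ => htd k) p hp' hv
  refine ⟨i, ?_⟩
  change 16 * (ε / T) ^ 2 ≤ influence i p
  have hT0 : (0 : ℝ) < (T : ℝ) := by exact_mod_cast hT
  have hT2 : (0 : ℝ) < (T : ℝ) ^ 2 := by positivity
  have hI := influence_nonneg i p
  have hεsq : ε ^ 2 ≤ boolVariance p ^ 2 := pow_le_pow_left₀ hε.le hεV' 2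
  rw [div_pow]
  rw [mul_div_assoc']
  rw [div_le_iff₀ hT2]
  calc 16 * ε ^ 2 ≤ 16 * boolVariance p ^ 2 := by linarith
    _ ≤ (T : ℝ) ^ 2 * influence i p := hi
    _ = influence i p * (T : ℝ) ^ 2 := mul_comm _ _

/-- The classical corner is indeed a corner of the crux: under the hypotheses of `pseudoBoundedAA_classicalCorner` the
polynomial `p` satisfies the SOS-sandwich hypothesis of the route item (literal inline form, `= PseudoBounded T p` by
`Iff.rfl`). [cite: KaniewskiLeeDewolf2015, Def. 7] -/
theorem classicalCorner_pseudoBounded (N T : ℕ) (p : MvPolynomial (Fin N) ℝ) :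
    let ev : MvPolynomial (Fin N) ℝ → (Fin N → Bool) → ℝ :=
      fun f x => MvPolynomial.eval (fun k => if x k then (1 : ℝ) else 0) f
    (∃ (m : ℕ) (w : Fin m → ℝ) (t : Fin m → DecisionTree N),
        (∀ k, 0 ≤ w k) ∧ ∑ k, w k = 1 ∧ (∀ k, (t k).depth ≤ T) ∧
          ∀ x : Fin N → Bool, ev p x = ∑ k, w k * (if (t k).eval x = true then (1 : ℝ) else 0)) →
    ∃ (m : ℕ) (q r : Fin m → MvPolynomial (Fin N) ℝ),
      (∀ j, (q j).totalDegree ≤ T ∧ (r j).totalDegree ≤ T) ∧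
        ∀ x : Fin N → Bool, ev p x = ∑ j, ev (q j) x ^ 2 ∧ 1 - ev p x = ∑ j, ev (r j) x ^ 2 := by
  intro ev hmix
  obtain ⟨m, w, t, hw, hw1, htd, hp⟩ := hmix
  have h : PseudoBounded T p := pseudoBounded_of_mixture w hw hw1 t T htd p hp
  exact h

end ClassicalCorner

end Summit.QuantumAdvantage.QuantumAdvantage.Theorems.SosSandwich

end
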